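import Summits.AnomalousDissipation.AnomalousDissipation.Theorems.GalerkinSteadyZerothLaw.Negative.StokesStates
import Literature.Analysis.FluidPDE.NSGalerkinStationary
import Literature.Analysis.FluidPDE.TorusConvectionBounds

/-!
# Stub-ideation k=2 (FAMILY 2 — RESHAPE) for `stub_loudCoatDecades` — elaboration sanity of the helper signatures

Crux stmt-AnomalousDissipation-2986 (`MirrorVariety.GalerkinSteadyZerothLaw`), line `idea-sketch-ideator2`
(skeleton `Cruxes/GalerkinSteadyZerothLaw/Lines/idea_sketch_ideator2.lean`).  Statements only (`sorry` bodies);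
see `STUB-IDEAS-stub_loudCoatDecades-2.md`.
-/

noncomputable section

set_option linter.dupNamespace false

open scoped InnerProductSpace Topology
open MeasureTheory Filter Set UnitAddTorus
open Literature.Analysis.FunctionSpaces Literature.Analysis.FunctionSpaces.Torus
open Literature.Analysis.FluidPDE Literature.Analysis.FluidPDE.Torus

namespace Summit.AnomalousDissipation.AnomalousDissipation.Cruxes.GalerkinSteadyZerothLaw.EulerCoreCoatReadout.StubIdeasK2

open Summit.AnomalousDissipation.AnomalousDissipation.Theorems.GalerkinSteadyZerothLaw.Negative
  (SteadyState fieldOf steadyState_fieldOf integral_norm_sq_fieldOf loudness_fieldOf)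
open Summit.AnomalousDissipation.AnomalousDissipation.Theorems.LaminarNeverLoud.Negative
  (modes forceCoeff energy dissipation modes_symm zero_not_mem_modes energy_nonneg dissipation_nonpos_of_nonpos)

/-- Coefficient vectors at level `N` (as in the skeleton). -/
abbrev Coeff (N : ℕ) : Type := ↥(modes (Fin 3) N) → EuclideanSpace ℂ (Fin 3)

/-! ## H1 — path packaging (RESHAPE: parametrise the coat family by arclength, not by `ν`) -/

/-- **H1 `coatSet_of_path`** (S, pure topology).  The image of a continuous path in `ℝ × X` is connected, and its
first coordinates cover every interval between the endpoints' first coordinates (IVT on `Prod.fst ∘ γ`).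
Mathlib: `isConnected_Icc`, `IsConnected.image`, `intermediate_value_Icc`. [folklore] -/
theorem coatSet_of_path {X : Type*} [TopologicalSpace X] (γ : ℝ → ℝ × X)
    (hγ : ContinuousOn γ (Icc (0 : ℝ) 1)) {a b : ℝ} (ha : (γ 0).1 ≤ a) (hb : b ≤ (γ 1).1) :
    IsConnected (γ '' Icc (0 : ℝ) 1) ∧ Icc a b ⊆ Prod.fst '' (γ '' Icc (0 : ℝ) 1) := by
  sorry

/-! ## H2 — an exact Euler core is a core at EVERY level `N ≥ K₀` (RESHAPE: kill the `N`-dependence of the core clause) -/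

/-- **H2 `eulerCore_restrict`** (S).  If `Cfun` is supported in `modes K₀` and its restriction to level `2K₀` is a
real solenoidal nonzero zero of the unforced inviscid Galerkin field, then so is its restriction to every level
`N ≥ K₀` (the convolution of a `K₀`-supported family only charges `|k| ≤ 2K₀`; `Finset.sum_subset` bookkeeping as
in `energy_restrict_eq`). [folklore] -/
theorem eulerCore_restrict {K₀ : ℕ} {Cfun : (Fin 3 → ℤ) → EuclideanSpace ℂ (Fin 3)}
    (hsupp : ∀ k ∉ modes (Fin 3) K₀, Cfun k = 0)
    (hcore : (fun k : ↥(modes (Fin 3) (2 * K₀)) => Cfun k) ∈ galerkinSubspace (modes (Fin 3) (2 * K₀)) ∧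
      (fun k : ↥(modes (Fin 3) (2 * K₀)) => Cfun k) ≠ 0 ∧
      galerkinRHS (modes (Fin 3) (2 * K₀)) 0 0 (fun k : ↥(modes (Fin 3) (2 * K₀)) => Cfun k) = 0)
    {N : ℕ} (hN : K₀ ≤ N) :
    (fun k : ↥(modes (Fin 3) N) => Cfun k) ∈ galerkinSubspace (modes (Fin 3) N) ∧
      (fun k : ↥(modes (Fin 3) N) => Cfun k) ≠ 0 ∧
      galerkinRHS (modes (Fin 3) N) 0 0 (fun k : ↥(modes (Fin 3) N) => Cfun k) = 0 := by
  sorry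

/-- **H2' `latNormSq_core_le`** (S).  The core field does not depend on the level and its lattice `H³` energy is
explicit: `latNormSq 3 (fieldOf N C) ≤ (1 + K₀²)³ · energy C` for the restriction `C` of a `K₀`-supported family,
`N ≥ K₀` (`mFourierCoeff_realTrigPoly`, `freqNormSq_le_of_mem_modes`). [folklore] -/
theorem latNormSq_core_le {K₀ N : ℕ} {Cfun : (Fin 3 → ℤ) → EuclideanSpace ℂ (Fin 3)}
    (hsupp : ∀ k ∉ modes (Fin 3) K₀, Cfun k = 0) (hN : K₀ ≤ N)
    (hC : (fun k : ↥(modes (Fin 3) N) => Cfun k) ∈ galerkinSubspace (modes (Fin 3) N)) :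
    latNormSq 3 (fieldOf N (fun k : ↥(modes (Fin 3) N) => Cfun k)) ≤
      (1 + (K₀ : ℝ) ^ 2) ^ 3 * energy (fun k : ↥(modes (Fin 3) N) => Cfun k) := by
  sorry

/-! ## H3 — orthogonal splitting over a SINGLE-SHELL core (RESHAPE: the window's cross terms vanish) -/

/-- **H3 `coat_split`** (S, coefficient algebra).  If the core lives on one shell `|k|² = n₀` and `h ⊥ C` in `ℓ²`,
then `h ⊥ C` in `ḣ¹` as well, so energy AND dissipation of `C + h` split. [folklore] -/
theorem coat_split {N : ℕ} {n₀ : ℝ} {C h : Coeff N}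
    (hshell : ∀ k : ↥(modes (Fin 3) N), C k ≠ 0 → freqNormSq (k : Fin 3 → ℤ) = n₀)
    (horth : (∑ k, (inner ℂ (C k) (h k)).re) = 0) (ν : ℝ) :
    energy (C + h) = energy C + energy h ∧
      dissipation ν (C + h) = dissipation ν C + dissipation ν h ∧
      dissipation ν C = ν * (4 * Real.pi ^ 2 * n₀) * energy C := by
  sorry

/-! ## H4 — the coat's own dissipation IS the production (RESHAPE: test the coat equation against the coat) -/

/-- **H4 `coat_dissipation_eq_production`** (M).  For a coat `h` over a single-shell Euler core `C` at level `N`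
(residual of `C + h` collinear with `C`), testing the coat equation against `fieldOf N h` with the master identity
`sum_re_inner_galerkinField_test` (force `0`), the core's exactness tested against the same field (master identity
at `ν = 0`), `integral_inner_convect_self_eq_zero` and `integral_inner_convect_eq_neg` gives
`ν‖∇h‖² = −∫ ⟪h̃, (h̃·∇)C̃⟫` — the Reynolds-stress work of the coat against the core strain. [folklore] -/
theorem coat_dissipation_eq_production {N : ℕ} {n₀ ν s : ℝ} {C h : Coeff N}
    (hC : C ∈ galerkinSubspace (modes (Fin 3) N)) (hcore : galerkinRHS (modes (Fin 3) N) 0 0 C = 0)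
    (hshell : ∀ k : ↥(modes (Fin 3) N), C k ≠ 0 → freqNormSq (k : Fin 3 → ℤ) = n₀)
    (hh : h ∈ galerkinSubspace (modes (Fin 3) N)) (horth : (∑ k, (inner ℂ (C k) (h k)).re) = 0)
    (hs : galerkinRHS (modes (Fin 3) N) ν 0 (C + h) = (-s) • C) :
    dissipation ν h = -∫ x, ⟪fieldOf N h x, convect (fieldOf N h) (fieldOf N C) x⟫_ℝ := by
  sorry

/-! ## H5 — production is bounded by the core strain times the coat energy -/

/-- **H5 `production_le`** (S given Literature).  `|∫ ⟪h̃, (h̃·∇)C̃⟫| ≤ c₃ √(latNormSq 3 C̃) · energy h`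
(`exists_trilinear_sup_right` with `A = z = h̃`, `B = C̃`; `latNormSq_zero` and `integral_norm_sq_fieldOf`). [folklore] -/
theorem production_le : ∃ c₃ : ℝ, 0 ≤ c₃ ∧ ∀ (N : ℕ) (C h : Coeff N),
    C ∈ galerkinSubspace (modes (Fin 3) N) → h ∈ galerkinSubspace (modes (Fin 3) N) →
    |∫ x, ⟪fieldOf N h x, convect (fieldOf N h) (fieldOf N C) x⟫_ℝ| ≤
      c₃ * Real.sqrt (latNormSq 3 (fieldOf N C)) * energy h := by
  sorry

/-! ## H★ — the reshaped heart: a PRODUCTION FLOOR on bounded connected coat families (crux-sized, NOT one cycle) -/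

/-- **H★ `CoatProductionFloor`** (the residual open content of the stub, in landed vocabulary).  ONE single-shell
exact Euler core `Cfun` (support in `modes K₀`, shell `|k|² = n₀`, exact at level `2K₀`), a coat-energy budget `Eh`,
a floor `ε₁ > 0` on the COAT'S OWN dissipation `ν‖∇h‖²` (= production, H4) and a ceiling viscosity `ν⋆` such that
for every ratio `ρ ≥ 1` some clamp viscosities `νlo j → 0⁺`, `ρ νlo j ≤ ν⋆`, carry — for every `j`, frequently in
`N` — a CONNECTED set of (viscosity, coat) pairs with `ν ≤ ν⋆`, `energy h ≤ Eh`, `ε₁ ≤ dissipation ν h`, projecting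
onto `[νlo j, ρ νlo j]`.  No window `[ε₁, M]`, no `M < ρ²ε₁`, no total-energy budget: those are DERIVED (assembly). -/
def CoatProductionFloor : Prop :=
  ∃ (K₀ : ℕ) (Cfun : (Fin 3 → ℤ) → EuclideanSpace ℂ (Fin 3)) (n₀ : ℝ),
    (∀ k ∉ modes (Fin 3) K₀, Cfun k = 0) ∧ (∀ k, Cfun k ≠ 0 → freqNormSq k = n₀) ∧
    ((fun k : ↥(modes (Fin 3) (2 * K₀)) => Cfun k) ∈ galerkinSubspace (modes (Fin 3) (2 * K₀)) ∧
      (fun k : ↥(modes (Fin 3) (2 * K₀)) => Cfun k) ≠ 0 ∧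
      galerkinRHS (modes (Fin 3) (2 * K₀)) 0 0 (fun k : ↥(modes (Fin 3) (2 * K₀)) => Cfun k) = 0) ∧
    ∃ (Eh ε₁ νstar : ℝ), 0 < ε₁ ∧ 0 < νstar ∧
      ∀ ρ : ℝ, 1 ≤ ρ → ∃ νlo : ℕ → ℝ, (∀ j, 0 < νlo j) ∧ (∀ j, ρ * νlo j ≤ νstar) ∧
        Tendsto νlo atTop (𝓝 0) ∧
        ∀ j, ∃ᶠ N in atTop, ∃ C : Coeff N, (C = fun k : ↥(modes (Fin 3) N) => Cfun k) ∧
          ∃ K : Set (ℝ × Coeff N), IsConnected K ∧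
            (∀ p ∈ K, (p.2 ∈ galerkinSubspace (modes (Fin 3) N) ∧ (∑ k, (inner ℂ (C k) (p.2 k)).re) = 0 ∧
                ∃ s : ℝ, galerkinRHS (modes (Fin 3) N) p.1 0 (C + p.2) = (-s) • C) ∧
              p.1 ≤ νstar ∧ energy p.2 ≤ Eh ∧ ε₁ ≤ dissipation p.1 p.2) ∧
            Set.Icc (νlo j) (ρ * νlo j) ⊆ Prod.fst '' K

/-! ## H6 — assembly: H★ ∧ H2 ∧ H2' ∧ H3 ∧ H4 ∧ H5 ⇒ the registered stub VERBATIM -/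

/-- **H6 `stub_loudCoatDecades_of_productionFloor`** (M, filters + real arithmetic; conclusion = the registered
signature verbatim).  Constants: `E_C := energy C₀`, `G := c₃ ((1+K₀²)³ E_C)^{1/2}`, `Eh⁺ := max Eh 0`,
`E₁ := E_C + Eh⁺`, `M := ν⋆·4π²n₀·E_C + G·Eh⁺`, `ρ := (M⁺/ε₁)^{1/2} + 2` (so `M < ρ²ε₁`, `ρ ≥ 1`), `νlo` from H★ at
this `ρ`.  On `K`: coat clause verbatim; `energy (C+h) = E_C + energy h ≤ E₁` (H3); `0 < p.1` from
`ε₁ ≤ dissipation p.1 h` (`dissipation_nonpos_of_nonpos`); floor `ε₁ ≤ dissipation ν h ≤ dissipation ν (C+h)` (H3);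
ceiling `dissipation ν (C+h) = ν·4π²n₀E_C + dissipation ν h ≤ ν⋆4π²n₀E_C + G·Eh⁺ = M` (H3, H4, H5, H2');
core clause from H2 via `Frequently.and_eventually (eventually_ge_atTop K₀)`. [folklore] -/
theorem stub_loudCoatDecades_of_productionFloor (hP : CoatProductionFloor) :
    ∃ (K₀ : ℕ) (Cfun : (Fin 3 → ℤ) → EuclideanSpace ℂ (Fin 3)), (∀ k ∉ modes (Fin 3) K₀, Cfun k = 0) ∧
    ∃ (E₁ ε₁ M ρ : ℝ) (νlo : ℕ → ℝ), 0 < ε₁ ∧ 0 < ρ ∧ M < ρ ^ 2 * ε₁ ∧ (∀ j, 0 < νlo j) ∧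
      Tendsto νlo atTop (𝓝 0) ∧
      ∀ j, ∃ᶠ N in atTop, ∃ C : ↥(modes (Fin 3) N) → EuclideanSpace ℂ (Fin 3),
        (C = fun k : ↥(modes (Fin 3) N) => Cfun k) ∧
        (C ∈ galerkinSubspace (modes (Fin 3) N) ∧ C ≠ 0 ∧ galerkinRHS (modes (Fin 3) N) 0 0 C = 0) ∧
        ∃ K : Set (ℝ × (↥(modes (Fin 3) N) → EuclideanSpace ℂ (Fin 3))), IsConnected K ∧
          (∀ p ∈ K, (p.2 ∈ galerkinSubspace (modes (Fin 3) N) ∧ (∑ k, (inner ℂ (C k) (p.2 k)).re) = 0 ∧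
              ∃ s : ℝ, galerkinRHS (modes (Fin 3) N) p.1 0 (C + p.2) = (-s) • C) ∧
            energy (C + p.2) ≤ E₁ ∧ ε₁ ≤ dissipation p.1 (C + p.2) ∧ dissipation p.1 (C + p.2) ≤ M) ∧
          Set.Icc (νlo j) (ρ * νlo j) ⊆ Prod.fst '' K := by
  sorry

/-! ## Corollary used by the falsifier: the amplitude gap of loud coats -/

/-- **`coat_energy_gap`** (S from H4+H5).  A coat whose own dissipation is `≥ ε₁` has `energy h ≥ ε₁ / G`:
loud coats stay a FIXED `ℓ²`-distance away from the trivial branch `h = 0` at every viscosity — the continua of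
H★ are global, never local, bifurcation objects. [folklore] -/
theorem coat_energy_gap {N : ℕ} {n₀ ν s ε₁ G : ℝ} {C h : Coeff N}
    (hC : C ∈ galerkinSubspace (modes (Fin 3) N)) (hcore : galerkinRHS (modes (Fin 3) N) 0 0 C = 0)
    (hshell : ∀ k : ↥(modes (Fin 3) N), C k ≠ 0 → freqNormSq (k : Fin 3 → ℤ) = n₀)
    (hh : h ∈ galerkinSubspace (modes (Fin 3) N)) (horth : (∑ k, (inner ℂ (C k) (h k)).re) = 0)
    (hs : galerkinRHS (modes (Fin 3) N) ν 0 (C + h) = (-s) • C) (hG : 0 < G)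
    (hprod : |∫ x, ⟪fieldOf N h x, convect (fieldOf N h) (fieldOf N C) x⟫_ℝ| ≤ G * energy h)
    (hloud : ε₁ ≤ dissipation ν h) : ε₁ / G ≤ energy h := by
  sorry

end Summit.AnomalousDissipation.AnomalousDissipation.Cruxes.GalerkinSteadyZerothLaw.EulerCoreCoatReadout.StubIdeasK2

end
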